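import Summits.ResolutionOfSingularities.ResolutionOfSingularities.Theorems.HomologicalConductorNoZenoRationalAscentDropIn
import HarnessLib

/-!
# Crux `NoZenoR` (stmt-ResolutionOfSingularities-19943) — Lipman (1.2) 1) mod B): the punctured-regular neighbourhood of an
# isolated singularity from a CLOSED singular locus, and the drop-in with the call site's binders

Route `ResolutionOfSingularities/HomologicalConductor` (cell decomp-res, hand leafhand-res-homologicalconduct-12 g1).
OURS: AI-written, weaker than expert review; nothing here is a statement of the manuscript under review (Hironaka 2017).
SUPPORT level (`--supports stmt-19943`), counted 0.  Def-free.  Named fact consumed: only the hypothesis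
`(hB : Lipman1969_1_2_B)`.

`hasRationalSingularity_of_isLocalization_of_B` (`…RationalAscentDropIn`) asks for a basic open `D(s) ∋ 𝔮` of `Spec B` whose
points other than `𝔮` are regular.  At the call site (`NoZeno.SandwichCluster.hasRationalSingularity_tower`) the local ring
`T = B_𝔮` is an ISOLATED SINGULARITY (`stage_package`); when moreover the singular locus of `Spec B` is CLOSED (`= V(I)`, e.g.
`B` essentially of finite type over a field: `Resolution.isOpen_regularLocus_of_locallyOfFiniteType_field`) and `𝔮` is
maximal, such an `s` exists: the minimal primes of `I` other than `𝔮` are not contained in `𝔮` (a singular prime `𝔭 ⊊ 𝔮` would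
be a singular non-maximal prime of `T`), so a product of elements `s_𝔭 ∈ 𝔭 ∖ 𝔮` works.

* `isRegularLocalRing_localization_of_le_of_isIsolatedSingularity` — `𝔭 ⊊ 𝔮`, `T = B_𝔮` an isolated singularity ⇒ `B_𝔭`
  regular (`T_{𝔭T} = B_𝔭`).
* `exists_basicOpen_regular_off_point` — the punctured-regular basic open.
* `hasRationalSingularity_of_isLocalization_of_B'` — the drop-in with binders «`𝔮` maximal, `T` an isolated singularity,
  singular locus of `Spec B` closed» in place of the basic open.

No crux, kill test or summit statement is proved; resolution of singularities in positive characteristic is NOT proved.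

## References
* J. Lipman, *Rational singularities …*, Publ. Math. IHÉS 36 (1969): Prop. (1.2) 1), p. 200. [Lipman1969]
* H. Matsumura, *Commutative Ring Theory* (1986): §4 (localization at primes), Thm. 6.5 (minimal primes). [Matsumura1987]
-/

noncomputable section

-- single-problem summit: the doubled namespace component `ResolutionOfSingularities` is forced
set_option linter.dupNamespace false

namespace Summit.ResolutionOfSingularities.ResolutionOfSingularities.Theorems.NoZeno.RationalAscent

open IsLocalRing
open Literature.AlgebraicGeometry.Resolution Literature.RingTheory.CohomologyAnnihilator

universe u

/-! ## Generizations of an isolated singularity are regular -/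

/-- **A prime strictly below the centre of an isolated singularity has regular localisation**: `T = B_𝔮` an isolated
singularity, `𝔭 ≤ 𝔮` a prime with `𝔭 ≠ 𝔮` ⇒ `B_𝔭` is a regular local ring (`B_𝔭 = T_{𝔭T}` and `𝔭T ≠ 𝔪_T`).
[cite: Matsumura1987, §4 (Thm. 4.3, localization of a localization)] -/
theorem isRegularLocalRing_localization_of_le_of_isIsolatedSingularity {B T : Type u} [CommRing B]
    (𝔮 : Ideal B) [𝔮.IsPrime] [CommRing T] [Algebra B T] [IsLocalRing T] [IsLocalization.AtPrime T 𝔮]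
    (hiso : IsIsolatedSingularity T) (𝔭 : Ideal B) [𝔭.IsPrime] (hle : 𝔭 ≤ 𝔮) (hne : 𝔭 ≠ 𝔮) :
    IsRegularLocalRing (Localization.AtPrime 𝔭) := by
  -- `P = 𝔭T` is a prime of `T` with `P ∩ B = 𝔭`, different from `𝔪_T = 𝔮T`
  have hdisj : Disjoint (𝔮.primeCompl : Set B) (𝔭 : Set B) :=
    Set.disjoint_left.mpr fun x hx hx𝔭 => hx (hle hx𝔭)
  haveI hP : (𝔭.map (algebraMap B T)).IsPrime :=
    IsLocalization.isPrime_of_isPrime_disjoint 𝔮.primeCompl T 𝔭 ‹𝔭.IsPrime› hdisj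
  have hcomap : (𝔭.map (algebraMap B T)).comap (algebraMap B T) = 𝔭 :=
    IsLocalization.under_map_of_isPrime_disjoint 𝔮.primeCompl T ‹𝔭.IsPrime› hdisj
  have hPne : 𝔭.map (algebraMap B T) ≠ maximalIdeal T := by
    intro h
    apply hne
    have h𝔮 : (𝔮.map (algebraMap B T)).comap (algebraMap B T) = 𝔮 :=
      IsLocalization.under_map_of_isPrime_disjoint 𝔮.primeCompl T ‹𝔮.IsPrime›
        (Set.disjoint_left.mpr fun x hx hx𝔮 => hx hx𝔮)
    rw [← hcomap, h, ← IsLocalization.AtPrime.map_eq_maximalIdeal 𝔮 T, h𝔮]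
  haveI hreg : IsRegularLocalRing (Localization.AtPrime (𝔭.map (algebraMap B T))) := hiso _ hPne
  -- `T_P` is the localisation of `B` at `P ∩ B = 𝔭`
  haveI : IsLocalization.AtPrime (Localization.AtPrime (𝔭.map (algebraMap B T)))
      ((𝔭.map (algebraMap B T)).comap (algebraMap B T)) :=
    IsLocalization.isLocalization_isLocalization_atPrime_isLocalization 𝔮.primeCompl _ _
  have e : Localization.AtPrime (𝔭.map (algebraMap B T)) ≃ₐ[B] Localization.AtPrime 𝔭 := by
    have h1 : ((𝔭.map (algebraMap B T)).comap (algebraMap B T)).primeCompl = 𝔭.primeCompl :=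
      Submonoid.ext fun y => by
        change y ∉ (𝔭.map (algebraMap B T)).comap (algebraMap B T) ↔ y ∉ 𝔭
        rw [hcomap]
    haveI : IsLocalization 𝔭.primeCompl (Localization.AtPrime (𝔭.map (algebraMap B T))) := by
      have h := this
      change IsLocalization _ _ at h
      rwa [h1] at h
    exact IsLocalization.algEquiv 𝔭.primeCompl _ _
  exact IsRegularLocalRing.of_ringEquiv e.toRingEquiv

/-! ## The punctured-regular basic open -/

/-- **Punctured-regular basic open neighbourhood of an isolated singularity with closed singular locus.**  `B` Noetherian,
`𝔮` a maximal ideal with `T = B_𝔮` an isolated singularity, and `I` an ideal cutting out the singular locus of `Spec B`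
(`B_𝔭` singular iff `I ≤ 𝔭`).  Then there is `s ∉ 𝔮` such that every prime `𝔭 ≠ 𝔮` with `s ∉ 𝔭` has `B_𝔭` regular.
[cite: Matsumura1987, Thm. 6.5 (finitely many minimal primes)] -/
theorem exists_basicOpen_regular_off_point {B T : Type u} [CommRing B] [IsNoetherianRing B]
    (𝔮 : Ideal B) [𝔮.IsMaximal] [CommRing T] [Algebra B T] [IsLocalRing T] [IsLocalization.AtPrime T 𝔮]
    (hiso : IsIsolatedSingularity T) (I : Ideal B)
    (hI : ∀ (𝔭 : Ideal B) [𝔭.IsPrime], ¬ IsRegularLocalRing (Localization.AtPrime 𝔭) ↔ I ≤ 𝔭) :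
    ∃ s : B, s ∉ 𝔮 ∧
      ∀ (𝔭 : Ideal B) [𝔭.IsPrime], s ∉ 𝔭 → 𝔭 ≠ 𝔮 → IsRegularLocalRing (Localization.AtPrime 𝔭) := by
  classical
  have hfin : I.minimalPrimes.Finite := Ideal.finite_minimalPrimes_of_isNoetherianRing B I
  -- every minimal prime of `I` other than `𝔮` contains an element outside `𝔮`
  have hout : ∀ 𝔭 ∈ I.minimalPrimes, 𝔭 ≠ 𝔮 → ∃ x ∈ 𝔭, x ∉ 𝔮 := by
    intro 𝔭 h𝔭 hne
    by_contra hcon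
    have hle : 𝔭 ≤ 𝔮 := fun y hy => by_contra fun hy𝔮 => hcon ⟨y, hy, hy𝔮⟩
    haveI : 𝔭.IsPrime := h𝔭.1.1
    have hreg := isRegularLocalRing_localization_of_le_of_isIsolatedSingularity 𝔮 hiso 𝔭 hle hne
    exact ((hI 𝔭).mpr h𝔭.1.2) hreg
  choose! x hx𝔭 hx𝔮 using hout
  refine ⟨∏ 𝔭 ∈ hfin.toFinset.filter (· ≠ 𝔮), x 𝔭, ?_, ?_⟩
  · -- the product is not in the prime `𝔮`
    intro hmem
    haveI : 𝔮.IsPrime := Ideal.IsMaximal.isPrime ‹𝔮.IsMaximal›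
    obtain ⟨𝔭, h𝔭, hx⟩ := Ideal.IsPrime.prod_mem_iff.mp hmem
    rw [Finset.mem_filter, Set.Finite.mem_toFinset] at h𝔭
    exact hx𝔮 𝔭 h𝔭.1 h𝔭.2 hx
  · intro 𝔭 _ hs hne
    by_contra hsing
    have hI𝔭 : I ≤ 𝔭 := (hI 𝔭).mp hsing
    obtain ⟨𝔭₀, h𝔭₀, h𝔭₀le⟩ := Ideal.exists_minimalPrimes_le hI𝔭
    by_cases h0 : 𝔭₀ = 𝔮
    · -- `𝔮 ≤ 𝔭` with `𝔮` maximal forces `𝔭 = 𝔮`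
      subst h0
      exact hne ((Ideal.IsMaximal.eq_of_le ‹𝔭₀.IsMaximal› Ideal.IsPrime.ne_top' h𝔭₀le).symm)
    · apply hs
      have hx : x 𝔭₀ ∈ 𝔭 := h𝔭₀le (hx𝔭 𝔭₀ h𝔭₀ h0)
      have hdvd : x 𝔭₀ ∣ ∏ 𝔭' ∈ hfin.toFinset.filter (· ≠ 𝔮), x 𝔭' :=
        Finset.dvd_prod_of_mem _ (by rw [Finset.mem_filter, Set.Finite.mem_toFinset]; exact ⟨h𝔭₀, h0⟩)
      obtain ⟨c, hc⟩ := hdvd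
      rw [hc]
      exact Ideal.mul_mem_right _ _ hx

/-! ## The drop-in with the call site's binders -/

/-- **Lipman (1.2) 1) in ring form over a REGULAR base, MODULO B), call-site binders**: as
`hasRationalSingularity_of_isLocalization_of_B`, with the punctured-regular basic open replaced by «`𝔮` maximal, `T = B_𝔮` an
isolated singularity, and the singular locus of `Spec B` closed (`= V(I)`)» — the form the W4.4 stage-rationality feed can
supply (`stage_package`: `IsIsolatedSingularity T_m`; excellence of the finitely generated model).
[cite: Lipman1969, Proposition (1.2) 1), proof p. 200 with footnote (1); statement B) (p. 200)] -/
theorem hasRationalSingularity_of_isLocalization_of_B' (hB : Lipman1969_1_2_B.{0}) {R B T : Type}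
    [CommRing R] [IsDomain R] [IsRegularLocalRing R] (hdimR : ringKrullDim R = 2)
    [CommRing B] [IsDomain B] [IsNoetherianRing B] [Algebra R B] [Algebra.FiniteType R B]
    (hinj : Function.Injective (algebraMap R B)) (r : R) (hr : r ≠ 0)
    (hden : ∀ b : B, ∃ n : ℕ, ∃ a : R, algebraMap R B a = algebraMap R B r ^ n * b)
    (𝔮 : Ideal B) [𝔮.IsMaximal] [CommRing T] [Algebra B T] [IsLocalRing T] [IsLocalization.AtPrime T 𝔮]
    (hdimT : ringKrullDim T = 2) (hiso : IsIsolatedSingularity T)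
    (I : Ideal B) (hI : ∀ (𝔭 : Ideal B) [𝔭.IsPrime], ¬ IsRegularLocalRing (Localization.AtPrime 𝔭) ↔ I ≤ 𝔭) :
    HasRationalSingularity T := by
  obtain ⟨s, hs, hreg⟩ := exists_basicOpen_regular_off_point 𝔮 hiso I hI
  exact hasRationalSingularity_of_isLocalization_of_B hB hdimR hinj r hr hden 𝔮 hdimT s hs
    (fun 𝔭 _ hs𝔭 hne => hreg 𝔭 hs𝔭 hne)

end Summit.ResolutionOfSingularities.ResolutionOfSingularities.Theorems.NoZeno.RationalAscent

end
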